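import Mathlib
import Literature.NumberTheory.Transcendental.PeriodsWave0
import Literature.NumberTheory.Transcendental.BakerLogarithmsAnalytic
import HarnessLib

/-!
# The six exponentials theorem for rational values

Trunk T-TRANSCEND (`Literature/NumberTheory/Transcendental`), family `periods`; a proved special
case of the named fact `Literature.NumberTheory.Transcendental.six_exponentials` (**periods.S14**, `PeriodsWave0.lean`).

**Theorem** (`Literature.NumberTheory.Transcendental.six_exponentials_rat`). If `x₁, x₂ ∈ ℂ` are linearly independent
over `ℚ` and `y₁, y₂, y₃ ∈ ℂ` are linearly independent over `ℚ`, then the six numbers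
`e^{xᵢ yⱼ}` are not all rational.

This is the six exponentials theorem (Siegel, Lang, Ramachandra: Lang 1966, Ch. II; Ramachandra
1968; Waldschmidt 2009, Thm. 3.9) restricted to *rational* rather than algebraic values — the
case Alaoglu and Erdős needed in 1944 ("Professor Siegel has communicated to us the result that
`q^x`, `r^x` and `s^x` can not be simultaneously rational except if `x` is an integer",
Trans. AMS 56, p. 455) and the only case the tree consumes (`Nat.not_three_ties`,
`ColossallyAbundantQuotient.lean`). Restricting to `ℚ` replaces the size (Liouville) inequality
of a number field by `|N| ≥ 1` for a nonzero integer `N`, and Siegel's lemma over a ring of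
integers by Mathlib's `Int.Matrix.exists_ne_zero_int_vec_norm_le`; the analytic half is verbatim
the classical one.

## Proof (Schneider's method, as in Waldschmidt 2009, §3.1.5, after Thm. 3.9)

Suppose `e^{xᵢ yⱼ} = rᵢⱼ = Aᵢⱼ/Bᵢⱼ ∈ ℚ` for all `i, j` (`SixExpRat.Setup`). Put
`C₀ = ∏ |Aᵢⱼ| Bᵢⱼ`, `X = ∑ |xᵢ|`, `Y = ∑ |yⱼ|`, `κ = 5XY + 3 log C₀`, and choose
`u = ⌈4κ⌉₊ + 3`, `S₀ = 2u²`, `L = 4u³` (so `L² = 2S₀³`).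
* *Auxiliary function.* `F(t) = ∑_{λ ∈ [0,L)²} a(λ) e^{(λ₁x₁+λ₂x₂) t}` with `a(λ) ∈ ℤ`. At a
  lattice point `z(k) = k₁y₁ + k₂y₂ + k₃y₃`, `e^{(λ·x) z(k)} = ∏ rᵢⱼ^{λᵢ kⱼ}`, so
  `D_T F(z(k)) = ∑_λ M_T(k, λ) a(λ)` with `D_T = ∏ Bᵢⱼ^{LT}` and an integer matrix `M_T` of
  entries `≤ C₀^{LT}` for `k ∈ [0,T)³` (`Setup.D_mul_F`, `Setup.abs_M_le`).
* *Siegel's lemma* (`S₀³` equations, `L² = 2S₀³` unknowns): some `a ≠ 0` with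
  `|a(λ)| ≤ L² C₀^{L S₀}` makes `F` vanish on the box `[0,S₀)³` (`Setup.exists_solution`).
* *Extrapolation* `T → T+1` (`T ≥ S₀`): if `F` vanishes on `[0,T)³` (that is `T³` distinct
  points of modulus `≤ TY`, distinct because the `yⱼ` are independent) and `k ∈ [0,T]³`, then
  the Schwarz lemma on the circle `|t| = 5TY` (the tree's `norm_le_of_analyticOrderAt`,
  `BakerLogarithmsAnalytic.lean`, with all multiplicities `1`) gives
  `|F(z(k))| ≤ 2^{-T³} L⁴ C₀^{LS₀} e^{5LXY·T}`, while `D_{T+1} F(z(k)) ∈ ℤ` gives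
  `|F(z(k))| ≥ C₀^{-L(T+1)}` unless it vanishes; and
  `4L + L(T+1) log C₀ + L S₀ log C₀ + 5LXYT ≤ 4L + LTκ ≤ T³/2 < T³ log 2` by the choice of
  `u` (`Setup.elim`).
* *Conclusion.* `F` vanishes at every `z(k)`, `k ∈ ℕ³`; the maps `k ↦ e^{(λ·x) z(k)}` are
  pairwise distinct characters of `ℕ³` (independence of the `xᵢ` and of the `yⱼ`), so Artin's
  theorem (`linearIndependent_monoidHom`) forces `a = 0` (`Setup.eq_zero_of_forall_F_eq_zero`).

## References

* [Lang1966] S. Lang, *Introduction to transcendental numbers*, Addison-Wesley, 1966, Ch. II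
  (six exponentials theorem; = "théorème 1 de Lang" of Erdős–Nicolas 1975, p. 70).
* [Waldschmidt2009] M. Waldschmidt, *Auxiliary functions in transcendental number theory*,
  Ramanujan J. 20 (2009), 341–373, §3.1 (Lemma 3.1, Thue–Siegel) and §3.1.5, Thm. 3.9
  ("due to Siegel, Lang and Ramachandra") with the sketch of the classical proof followed here.
* [AlaogluErdos1944] L. Alaoglu, P. Erdős, Trans. AMS 56 (1944), p. 455 (Siegel's
  communication: the rational case).
-/

noncomputable section

open Complex Finset Metric

namespace Literature.NumberTheory.Transcendental

namespace SixExpRat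

/-- An integer combination of a `ℚ`-linearly independent family that vanishes is trivial.
[folklore] -/
theorem eq_zero_of_sum_intCast_mul_eq_zero {ι : Type*} [Fintype ι] {v : ι → ℂ}
    (hv : LinearIndependent ℚ v) (g : ι → ℤ) (h : ∑ i, (g i : ℂ) * v i = 0) (i : ι) :
    g i = 0 := by
  have h' : ∑ i, (g i : ℚ) • v i = 0 := by
    simpa [Rat.smul_def] using h
  have := Fintype.linearIndependent_iff.1 hv (fun i => (g i : ℚ)) h' i
  exact_mod_cast this

/-- The data of a would-be counterexample to the rational six exponentials theorem: `x`, `y`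
linearly independent over `ℚ` with all `e^{xᵢ yⱼ}` rational. [cite: Waldschmidt2009, Thm. 3.9] -/
structure Setup where
  /-- the two "exponents" -/
  x : Fin 2 → ℂ
  /-- the three "logarithms" -/
  y : Fin 3 → ℂ
  hx : LinearIndependent ℚ x
  hy : LinearIndependent ℚ y
  /-- the rational values `exp (x i * y j)` -/
  r : Fin 2 → Fin 3 → ℚ
  hr : ∀ i j, cexp (x i * y j) = r i j

namespace Setup

variable (S : Setup)

/-- The values `rᵢⱼ = e^{xᵢyⱼ}` are nonzero. [folklore] -/
theorem r_ne_zero (i : Fin 2) (j : Fin 3) : S.r i j ≠ 0 := by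
  intro h
  have := S.hr i j
  rw [h, Rat.cast_zero] at this
  exact Complex.exp_ne_zero _ this

/-- Numerators `Aᵢⱼ` of the values `rᵢⱼ`. [folklore] -/
def A (i : Fin 2) (j : Fin 3) : ℤ := (S.r i j).num

/-- Denominators `Bᵢⱼ` of the values `rᵢⱼ`. [folklore] -/
def B (i : Fin 2) (j : Fin 3) : ℕ := (S.r i j).den

/-- Numerators are nonzero. [folklore] -/
theorem A_ne_zero (i : Fin 2) (j : Fin 3) : S.A i j ≠ 0 :=
  Rat.num_ne_zero.2 (S.r_ne_zero i j)

/-- Denominators are positive. [folklore] -/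
theorem B_pos (i : Fin 2) (j : Fin 3) : 0 < S.B i j := (S.r i j).den_pos

/-- `|Aᵢⱼ| ≥ 1`. [folklore] -/
theorem one_le_natAbs_A (i : Fin 2) (j : Fin 3) : 1 ≤ (S.A i j).natAbs :=
  Int.natAbs_pos.2 (S.A_ne_zero i j)

/-- `rᵢⱼ = Aᵢⱼ / Bᵢⱼ` in `ℂ`. [folklore] -/
theorem r_eq (i : Fin 2) (j : Fin 3) : (S.r i j : ℂ) = (S.A i j : ℂ) / (S.B i j : ℂ) := by
  rw [A, B, ← Rat.cast_intCast, ← Rat.cast_natCast, ← Rat.cast_div, Rat.num_div_den]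

/-- The size constant `C₀ = ∏ |A i j| B i j ≥ 1`. [folklore] -/
def C₀ : ℕ := ∏ i, ∏ j, (S.A i j).natAbs * S.B i j

/-- `C₀ ≥ 1`. [folklore] -/
theorem one_le_C₀ : 1 ≤ S.C₀ := by
  unfold C₀
  refine Finset.one_le_prod' fun i _ => Finset.one_le_prod' fun j _ => ?_
  exact one_le_mul (S.one_le_natAbs_A i j) (S.B_pos i j)

/-- The frequency attached to an index `λ : Fin 2 → Fin L`: `w λ = ∑ λᵢ xᵢ` (Waldschmidt 2009,
§3.1.5: `F(z) = P(e^{x₁z}, e^{x₂z})`). [cite: Waldschmidt2009, §3.1.5] -/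
def w (L : ℕ) (l : Fin 2 → Fin L) : ℂ := ∑ i, ((l i : ℕ) : ℂ) * S.x i

/-- The lattice point attached to `k : Fin 3 → ℕ`: `z k = ∑ kⱼ yⱼ` (Waldschmidt 2009, §3.1.5:
"points of the form `s₁y₁ + ⋯ + s_ℓ y_ℓ`"). [cite: Waldschmidt2009, §3.1.5] -/
def z (k : Fin 3 → ℕ) : ℂ := ∑ j, ((k j : ℕ) : ℂ) * S.y j

/-- `z(0) = 0`. [folklore] -/
theorem z_zero : S.z 0 = 0 := by simp [z]

/-- `z` is additive. [folklore] -/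
theorem z_add (k k' : Fin 3 → ℕ) : S.z (k + k') = S.z k + S.z k' := by
  simp [z, add_mul, sum_add_distrib]

/-- The auxiliary exponential polynomial `F(t) = ∑ a(λ) e^{w(λ) t}` (Waldschmidt 2009, §3.1.5).
[cite: Waldschmidt2009, §3.1.5] -/
def F (L : ℕ) (a : (Fin 2 → Fin L) → ℤ) (t : ℂ) : ℂ :=
  ∑ l, (a l : ℂ) * cexp (S.w L l * t)

/-- `F` is entire. [folklore] -/
theorem differentiable_F (L : ℕ) (a : (Fin 2 → Fin L) → ℤ) : Differentiable ℂ (S.F L a) := by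
  unfold F; fun_prop

/-- The values of the exponentials at lattice points are products of the rationals `r i j`.
[folklore] -/
theorem exp_w_mul_z (L : ℕ) (l : Fin 2 → Fin L) (k : Fin 3 → ℕ) :
    cexp (S.w L l * S.z k) = ∏ i, ∏ j, (S.r i j : ℂ) ^ ((l i : ℕ) * k j) := by
  rw [w, z, Finset.sum_mul_sum, Complex.exp_sum]
  refine Finset.prod_congr rfl fun i _ => ?_
  rw [Complex.exp_sum]
  refine Finset.prod_congr rfl fun j _ => ?_
  rw [← S.hr i j, ← Complex.exp_nat_mul]
  congr 1
  push_cast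
  ring

/-- The integer matrix of the linear system at level `T` (rows `k : Fin 3 → Fin T`, columns
`λ : Fin 2 → Fin L`): `D_T · e^{w(λ) z(k)}`. [folklore] -/
def M (L T : ℕ) : Matrix (Fin 3 → Fin T) (Fin 2 → Fin L) ℤ := fun k l =>
  ∏ i, ∏ j, S.A i j ^ ((l i : ℕ) * (k j : ℕ)) * (S.B i j : ℤ) ^ (L * T - (l i : ℕ) * (k j : ℕ))

/-- The common denominator `D_T = ∏ Bᵢⱼ^{LT}` at level `T`. [folklore] -/
def D (L T : ℕ) : ℤ := ∏ i : Fin 2, ∏ j : Fin 3, (S.B i j : ℤ) ^ (L * T)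

/-- `D_T ≠ 0`. [folklore] -/
theorem D_ne_zero (L T : ℕ) : S.D L T ≠ 0 := by
  unfold D
  refine Finset.prod_ne_zero_iff.2 fun i _ => Finset.prod_ne_zero_iff.2 fun j _ => ?_
  exact pow_ne_zero _ (by exact_mod_cast (S.B_pos i j).ne')

/-- `λᵢ kⱼ ≤ L T` for `λᵢ < L`, `kⱼ < T`. [folklore] -/
theorem le_mul_of_fin {L T : ℕ} (l : Fin L) (k : Fin T) : (l : ℕ) * (k : ℕ) ≤ L * T :=
  Nat.mul_le_mul l.isLt.le k.isLt.le

/-- `D_T e^{w(λ) z(k)} = M_T(k, λ)` for `k` in the box of side `T`. [folklore] -/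
theorem D_mul_exp (L T : ℕ) (l : Fin 2 → Fin L) (k : Fin 3 → Fin T) :
    (S.D L T : ℂ) * cexp (S.w L l * S.z (fun j => (k j : ℕ))) = (S.M L T k l : ℂ) := by
  rw [exp_w_mul_z, D, M]
  push_cast
  rw [← Finset.prod_mul_distrib]
  refine Finset.prod_congr rfl fun i _ => ?_
  rw [← Finset.prod_mul_distrib]
  refine Finset.prod_congr rfl fun j _ => ?_
  have hB : (S.B i j : ℂ) ≠ 0 := by exact_mod_cast (S.B_pos i j).ne'
  have hle : (l i : ℕ) * (k j : ℕ) ≤ L * T := le_mul_of_fin (l i) (k j)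
  rw [S.r_eq, div_pow, ← Nat.sub_add_cancel hle, pow_add, Nat.add_sub_cancel]
  field_simp

/-- `D_T F(z(k)) = (M_T a)(k)`. [folklore] -/
theorem D_mul_F (L T : ℕ) (a : (Fin 2 → Fin L) → ℤ) (k : Fin 3 → Fin T) :
    (S.D L T : ℂ) * S.F L a (S.z (fun j => (k j : ℕ))) = ((S.M L T).mulVec a k : ℂ) := by
  simp only [F, Finset.mul_sum, Matrix.mulVec, dotProduct]
  push_cast
  refine Finset.sum_congr rfl fun l _ => ?_
  rw [← S.D_mul_exp L T l k]
  ring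

/-! ### Sizes -/

/-- The entries of `M_T` are bounded by `C₀^{LT}` (Waldschmidt 2009, §3.1: the size `A` of the
coefficients in the Thue–Siegel lemma). [cite: Waldschmidt2009, §3.1 Lemma 3.1] -/
theorem abs_M_le (L T : ℕ) (k : Fin 3 → Fin T) (l : Fin 2 → Fin L) :
    |(S.M L T k l : ℝ)| ≤ (S.C₀ : ℝ) ^ (L * T) := by
  rw [M, C₀]
  push_cast
  rw [Finset.abs_prod, ← Finset.prod_pow]
  refine Finset.prod_le_prod (fun i _ => abs_nonneg _) fun i _ => ?_
  rw [Finset.abs_prod, ← Finset.prod_pow]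
  refine Finset.prod_le_prod (fun j _ => abs_nonneg _) fun j _ => ?_
  have hA : (1 : ℝ) ≤ |(S.A i j : ℝ)| := by
    rw [← Int.cast_abs]; exact_mod_cast Int.one_le_abs (S.A_ne_zero i j)
  have hB : (1 : ℝ) ≤ (S.B i j : ℝ) := by exact_mod_cast S.B_pos i j
  have hle : (l i : ℕ) * (k j : ℕ) ≤ L * T := le_mul_of_fin (l i) (k j)
  rw [abs_mul, abs_pow, abs_pow, abs_of_nonneg (by positivity : (0 : ℝ) ≤ (S.B i j : ℝ)),
    Nat.cast_natAbs, Int.cast_abs, mul_pow]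
  exact mul_le_mul (pow_le_pow_right₀ hA hle) (pow_le_pow_right₀ hB (Nat.sub_le _ _))
    (by positivity) (by positivity)

/-- `D_T ≥ 1`. [folklore] -/
theorem one_le_D (L T : ℕ) : (1 : ℝ) ≤ (S.D L T : ℝ) := by
  rw [D]
  push_cast
  refine Finset.one_le_prod fun i _ => Finset.one_le_prod fun j _ => ?_
  exact one_le_pow₀ (by exact_mod_cast S.B_pos i j)

/-- `D_T ≤ C₀^{LT}`. [folklore] -/
theorem D_le (L T : ℕ) : (S.D L T : ℝ) ≤ (S.C₀ : ℝ) ^ (L * T) := by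
  rw [D, C₀]
  push_cast
  rw [← Finset.prod_pow]
  refine Finset.prod_le_prod (fun _ _ => by positivity) fun i _ => ?_
  rw [← Finset.prod_pow]
  refine Finset.prod_le_prod (fun _ _ => by positivity) fun j _ => ?_
  have hA : (1 : ℝ) ≤ |(S.A i j : ℝ)| := by
    rw [← Int.cast_abs]; exact_mod_cast Int.one_le_abs (S.A_ne_zero i j)
  rw [Nat.cast_natAbs, Int.cast_abs, mul_pow]
  exact le_mul_of_one_le_left (by positivity) (one_le_pow₀ hA)

/-- `|D_T v| ≤ C₀^{LT} |v|`. [folklore] -/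
theorem norm_D_mul_le (L T : ℕ) (v : ℂ) :
    ‖(S.D L T : ℂ) * v‖ ≤ (S.C₀ : ℝ) ^ (L * T) * ‖v‖ := by
  rw [norm_mul, Complex.norm_intCast, abs_of_nonneg (zero_le_one.trans (S.one_le_D L T))]
  exact mul_le_mul_of_nonneg_right (S.D_le L T) (norm_nonneg _)

/-! ### Siegel's lemma at the base level `S₀ = 2u²`, `L = 4u³` (`L² = 2 S₀³`) -/

section Siegel

attribute [local instance] Matrix.seminormedAddCommGroup

/-- **Siegel's lemma step** (Waldschmidt 2009, §3.1, Lemma 3.1 = Mathlib's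
`Int.Matrix.exists_ne_zero_int_vec_norm_le`): with `L = 4u³`, `S₀ = 2u²` (so that there are
`L² = 2S₀³` unknowns for `S₀³` equations and the Siegel exponent is `1`) there is a nonzero
integer vector `a` with `M_{S₀} a = 0` and `|a(λ)| ≤ L² C₀^{L S₀}`.
[cite: Waldschmidt2009, §3.1 Lemma 3.1] -/
theorem exists_solution (u : ℕ) (hu : 1 ≤ u) {L S₀ : ℕ} (hL : L = 4 * u ^ 3)
    (hS₀ : S₀ = 2 * u ^ 2) :
    ∃ a : (Fin 2 → Fin L) → ℤ, a ≠ 0 ∧ (S.M L S₀).mulVec a = 0 ∧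
      ∀ l, |(a l : ℝ)| ≤ (L : ℝ) ^ 2 * (S.C₀ : ℝ) ^ (L * S₀) := by
  have hm : Fintype.card (Fin 3 → Fin S₀) = S₀ ^ 3 := by simp
  have hn : Fintype.card (Fin 2 → Fin L) = L ^ 2 := by simp
  have hLS : L ^ 2 = 2 * S₀ ^ 3 := by rw [hL, hS₀]; ring
  have hS₀pos : 0 < S₀ := by rw [hS₀]; positivity
  have hcard_lt : Fintype.card (Fin 3 → Fin S₀) < Fintype.card (Fin 2 → Fin L) := by
    rw [hm, hn, hLS]; have := pow_pos hS₀pos 3; omega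
  have hcard_pos : 0 < Fintype.card (Fin 3 → Fin S₀) := by rw [hm]; positivity
  obtain ⟨a, ha0, hMa, hnorm⟩ :=
    Int.Matrix.exists_ne_zero_int_vec_norm_le (S.M L S₀) hcard_lt hcard_pos
  refine ⟨a, ha0, hMa, fun l => ?_⟩
  have hexp : ((Fintype.card (Fin 3 → Fin S₀) : ℝ) /
      (Fintype.card (Fin 2 → Fin L) - Fintype.card (Fin 3 → Fin S₀))) = 1 := by
    rw [hm, hn, hLS]
    push_cast
    have : (0 : ℝ) < (S₀ : ℝ) ^ 3 := by positivity
    field_simp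
    ring
  rw [hexp, Real.rpow_one, hn] at hnorm
  have hC : (1 : ℝ) ≤ (S.C₀ : ℝ) ^ (L * S₀) := one_le_pow₀ (by exact_mod_cast S.one_le_C₀)
  have hMnorm : ‖S.M L S₀‖ ≤ (S.C₀ : ℝ) ^ (L * S₀) := by
    rw [Matrix.norm_le_iff (by positivity)]
    intro k l'
    rw [Int.norm_eq_abs]
    exact S.abs_M_le L S₀ k l'
  calc |(a l : ℝ)| = ‖a l‖ := (Int.norm_eq_abs _).symm
    _ ≤ ‖a‖ := norm_le_pi_norm a l
    _ ≤ (L ^ 2 : ℕ) * max 1 ‖S.M L S₀‖ := hnorm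
    _ ≤ (L ^ 2 : ℕ) * (S.C₀ : ℝ) ^ (L * S₀) := by
        gcongr
        exact max_le hC hMnorm
    _ = (L : ℝ) ^ 2 * (S.C₀ : ℝ) ^ (L * S₀) := by push_cast; ring

end Siegel

/-! ### Growth of the auxiliary function -/

/-- `X = ∑ ‖xᵢ‖`. [folklore] -/
def X : ℝ := ∑ i, ‖S.x i‖

/-- `Y = ∑ ‖yⱼ‖`. [folklore] -/
def Y : ℝ := ∑ j, ‖S.y j‖

/-- `X ≥ 0`. [folklore] -/
theorem X_nonneg : 0 ≤ S.X := Finset.sum_nonneg fun _ _ => norm_nonneg _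

/-- `Y > 0` (a linearly independent family has no zero member). [folklore] -/
theorem Y_pos : 0 < S.Y := by
  have h0 : S.y 0 ≠ 0 := S.hy.ne_zero 0
  unfold Y
  rw [Fin.sum_univ_three]
  have := norm_pos_iff.2 h0
  positivity

/-- `|w(λ)| ≤ L X`. [folklore] -/
theorem norm_w_le (L : ℕ) (l : Fin 2 → Fin L) : ‖S.w L l‖ ≤ L * S.X := by
  unfold w X
  rw [Finset.mul_sum]
  refine (norm_sum_le _ _).trans (Finset.sum_le_sum fun i _ => ?_)
  rw [norm_mul, Complex.norm_natCast]
  exact mul_le_mul_of_nonneg_right (by exact_mod_cast (l i).isLt.le) (norm_nonneg _)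

/-- `|z(k)| ≤ T Y` on the box `kⱼ ≤ T`. [folklore] -/
theorem norm_z_le {T : ℕ} (k : Fin 3 → ℕ) (hk : ∀ j, k j ≤ T) : ‖S.z k‖ ≤ T * S.Y := by
  unfold z Y
  rw [Finset.mul_sum]
  refine (norm_sum_le _ _).trans (Finset.sum_le_sum fun j _ => ?_)
  rw [norm_mul, Complex.norm_natCast]
  exact mul_le_mul_of_nonneg_right (by exact_mod_cast hk j) (norm_nonneg _)

/-- Growth of the auxiliary function: `|F(t)| ≤ L² · max|a| · e^{L X |t|}`. [folklore] -/
theorem norm_F_le (L : ℕ) (a : (Fin 2 → Fin L) → ℤ) {Amax : ℝ} (hA : ∀ l, |(a l : ℝ)| ≤ Amax)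
    (t : ℂ) : ‖S.F L a t‖ ≤ (L : ℝ) ^ 2 * Amax * Real.exp (L * S.X * ‖t‖) := by
  unfold F
  refine (norm_sum_le _ _).trans ?_
  have hterm : ∀ l : Fin 2 → Fin L,
      ‖(a l : ℂ) * cexp (S.w L l * t)‖ ≤ Amax * Real.exp (L * S.X * ‖t‖) := by
    intro l
    rw [norm_mul, Complex.norm_intCast, Complex.norm_exp]
    have hA0 : 0 ≤ Amax := (abs_nonneg _).trans (hA l)
    gcongr
    · exact hA l
    · calc (S.w L l * t).re ≤ ‖S.w L l * t‖ := Complex.re_le_norm _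
        _ = ‖S.w L l‖ * ‖t‖ := norm_mul _ _
        _ ≤ L * S.X * ‖t‖ := mul_le_mul_of_nonneg_right (S.norm_w_le L l) (norm_nonneg _)
  calc ∑ l, ‖(a l : ℂ) * cexp (S.w L l * t)‖
      ≤ ∑ _l : Fin 2 → Fin L, Amax * Real.exp (L * S.X * ‖t‖) := Finset.sum_le_sum fun l _ => hterm l
    _ = (L : ℝ) ^ 2 * Amax * Real.exp (L * S.X * ‖t‖) := by
        rw [Finset.sum_const, Finset.card_univ, Fintype.card_fun, Fintype.card_fin,
          Fintype.card_fin, nsmul_eq_mul]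
        push_cast
        ring

/-! ### Distinct lattice points -/

/-- Distinct `k` give distinct lattice points `z(k)` (independence of the `yⱼ`). [folklore] -/
theorem z_injective : Function.Injective S.z := by
  intro k k' h
  have h0 : ∑ j, (((k j : ℤ) - (k' j : ℤ) : ℤ) : ℂ) * S.y j = 0 := by
    have : S.z k - S.z k' = 0 := sub_eq_zero.2 h
    rw [z, z, ← Finset.sum_sub_distrib] at this
    rw [← this]
    refine Finset.sum_congr rfl fun j _ => ?_
    push_cast
    ring
  funext j
  have := eq_zero_of_sum_intCast_mul_eq_zero S.hy _ h0 j
  omega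

/-! ### The characters `k ↦ e^{w(λ) z(k)}` and Artin's independence -/

/-- The character `k ↦ e^{w(λ) z(k)}` of `ℕ³` attached to `λ`. [folklore] -/
def chi (L : ℕ) (l : Fin 2 → Fin L) : Multiplicative (Fin 3 → ℕ) →* ℂ where
  toFun k := cexp (S.w L l * S.z (Multiplicative.toAdd k))
  map_one' := by simp [z_zero]
  map_mul' k k' := by
    rw [toAdd_mul, z_add, mul_add, Complex.exp_add]

/-- Unfolding of `chi`. [folklore] -/
theorem chi_apply (L : ℕ) (l : Fin 2 → Fin L) (k : Fin 3 → ℕ) :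
    S.chi L l (Multiplicative.ofAdd k) = cexp (S.w L l * S.z k) := rfl

/-- `z(eⱼ) = yⱼ`. [folklore] -/
theorem z_single (j : Fin 3) : S.z (Pi.single j 1) = S.y j := by
  unfold z
  rw [Finset.sum_eq_single j]
  · simp
  · intro j' _ hj'
    simp [hj']
  · simp

/-- Distinct `λ` give distinct frequencies `w(λ)` (independence of the `xᵢ`). [folklore] -/
theorem w_injective (L : ℕ) : Function.Injective (S.w L) := by
  intro l m h
  have h0 : ∑ i, ((((l i : ℕ) : ℤ) - ((m i : ℕ) : ℤ) : ℤ) : ℂ) * S.x i = 0 := by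
    have : S.w L l - S.w L m = 0 := sub_eq_zero.2 h
    rw [w, w, ← Finset.sum_sub_distrib] at this
    rw [← this]
    refine Finset.sum_congr rfl fun i _ => ?_
    push_cast
    ring
  funext i
  have := eq_zero_of_sum_intCast_mul_eq_zero S.hx _ h0 i
  exact Fin.ext (by omega)

/-- The characters `chi λ` are pairwise distinct: equality at `e₀, e₁` would give
`(w(λ) - w(μ)) yⱼ ∈ 2πiℤ` for `j = 0, 1`, hence a `ℤ`-relation between `y₀` and `y₁`
(Waldschmidt 2009, §3.1.5: "the conclusion then easily follows"). [folklore] -/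
theorem chi_injective (L : ℕ) : Function.Injective (S.chi L) := by
  intro l m hlm
  have key : ∀ j, ∃ n : ℤ, S.w L l * S.y j = S.w L m * S.y j + n * (2 * Real.pi * I) := by
    intro j
    have := congrArg (fun χ : Multiplicative (Fin 3 → ℕ) →* ℂ => χ (Multiplicative.ofAdd (Pi.single j 1))) hlm
    simp only [chi_apply, z_single] at this
    exact Complex.exp_eq_exp_iff_exists_int.1 this
  by_cases hd : S.w L l - S.w L m = 0
  · exact S.w_injective L (sub_eq_zero.1 hd)
  · exfalso
    obtain ⟨n₀, h₀⟩ := key 0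
    obtain ⟨n₁, h₁⟩ := key 1
    -- `d y₀ = n₀ c`, `d y₁ = n₁ c` with `d ≠ 0` force an integer relation `n₁ y₀ - n₀ y₁ = 0`
    have e₀ : (S.w L l - S.w L m) * S.y 0 = n₀ * (2 * Real.pi * I) := by rw [sub_mul, h₀]; ring
    have e₁ : (S.w L l - S.w L m) * S.y 1 = n₁ * (2 * Real.pi * I) := by rw [sub_mul, h₁]; ring
    have hrel : (S.w L l - S.w L m) * ((n₁ : ℂ) * S.y 0 - (n₀ : ℂ) * S.y 1) = 0 := by
      calc (S.w L l - S.w L m) * ((n₁ : ℂ) * S.y 0 - (n₀ : ℂ) * S.y 1)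
          = n₁ * ((S.w L l - S.w L m) * S.y 0) - n₀ * ((S.w L l - S.w L m) * S.y 1) := by ring
        _ = 0 := by rw [e₀, e₁]; ring
    have hrel' : (n₁ : ℂ) * S.y 0 - (n₀ : ℂ) * S.y 1 = 0 :=
      (mul_eq_zero.1 hrel).resolve_left hd
    have hsum : ∑ j, ((![n₁, -n₀, 0] : Fin 3 → ℤ) j : ℂ) * S.y j = 0 := by
      rw [Fin.sum_univ_three]
      simp only [Matrix.cons_val_zero, Matrix.cons_val_one, Matrix.cons_val]
      push_cast
      linear_combination hrel'
    have hn₁ : n₁ = 0 := by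
      simpa using eq_zero_of_sum_intCast_mul_eq_zero S.hy _ hsum 0
    have hn₀ : n₀ = 0 := by
      simpa using eq_zero_of_sum_intCast_mul_eq_zero S.hy _ hsum 1
    have hy0 : S.y 0 = 0 := by
      rw [hn₀, Int.cast_zero, zero_mul] at e₀
      exact (mul_eq_zero.1 e₀).resolve_left hd
    exact S.hy.ne_zero 0 hy0

/-- **Endgame**: if `F` vanishes at every lattice point then all its coefficients vanish
(Artin's theorem on the linear independence of characters, `linearIndependent_monoidHom`;
Waldschmidt 2009, §3.1.5: "one deduces that `F` vanishes at all such points, and the conclusion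
then easily follows"). [cite: Waldschmidt2009, §3.1.5] -/
theorem eq_zero_of_forall_F_eq_zero (L : ℕ) (a : (Fin 2 → Fin L) → ℤ)
    (h : ∀ k : Fin 3 → ℕ, S.F L a (S.z k) = 0) : a = 0 := by
  have hli := (linearIndependent_monoidHom (Multiplicative (Fin 3 → ℕ)) ℂ).comp (S.chi L)
    (S.chi_injective L)
  have hsum : ∑ l, (a l : ℂ) • ((S.chi L l : Multiplicative (Fin 3 → ℕ) →* ℂ) :
      Multiplicative (Fin 3 → ℕ) → ℂ) = 0 := by
    funext k
    simp only [Finset.sum_apply, Pi.smul_apply, smul_eq_mul, Pi.zero_apply]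
    have := h (Multiplicative.toAdd k)
    simpa [F, chi] using this
  funext l
  have := Fintype.linearIndependent_iff.1 hli (fun l => (a l : ℂ)) hsum l
  exact_mod_cast this

end Setup

/-! ### The extrapolation inequality (Schwarz lemma with `#s` simple zeros) -/

open Baker1975.Analytic in
/-- If the entire function `f` vanishes on a finite set `s` inside `|z| ≤ R₁` and `|f| ≤ θ` on
`|z| = 5R₁`, then `|f(w)| ≤ θ 2^{-#s}` for `|w| ≤ R₁`. [folklore] -/
theorem norm_le_of_forall_eq_zero {f : ℂ → ℂ} (hf : Differentiable ℂ f) (s : Finset ℂ)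
    {R₁ θ : ℝ} (hR₁ : 0 < R₁) (hs : ∀ c ∈ s, ‖c‖ ≤ R₁) (h0 : ∀ c ∈ s, f c = 0)
    (hθ : ∀ z ∈ sphere (0 : ℂ) (5 * R₁), ‖f z‖ ≤ θ) {w : ℂ} (hw : ‖w‖ ≤ R₁) :
    ‖f w‖ ≤ θ / 2 ^ s.card := by
  have horder : ∀ c ∈ s, ((1 : ℕ) : ℕ∞) ≤ analyticOrderAt f c := fun c hc =>
    le_analyticOrderAt_of_iteratedDeriv_eq_zero hf fun j hj => by
      interval_cases j
      simpa using h0 c hc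
  have hθ0 : 0 ≤ θ := by
    have h5 : ((5 * R₁ : ℝ) : ℂ) ∈ sphere (0 : ℂ) (5 * R₁) := by
      simp [abs_of_pos hR₁]
    exact (norm_nonneg _).trans (hθ _ h5)
  have hmF : ∀ z ∈ sphere (0 : ℂ) (5 * R₁), (4 * R₁) ^ (1 * s.card) ≤ ‖∏ c ∈ s, (z - c) ^ 1‖ := by
    intro z hz
    refine le_norm_prod_pow s 1 (by positivity) fun c hc => ?_
    have hz' : ‖z‖ = 5 * R₁ := by simpa using hz
    calc 4 * R₁ = 5 * R₁ - R₁ := by ring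
      _ ≤ ‖z‖ - ‖c‖ := by rw [hz']; linarith [hs c hc]
      _ ≤ ‖z - c‖ := norm_sub_norm_le z c
  have h := norm_le_of_analyticOrderAt hf s 1 horder (R := 5 * R₁) (by positivity) hθ
    (m := (4 * R₁) ^ (1 * s.card)) (by positivity) hmF (w := w) (by linarith)
  have hFw : ‖∏ c ∈ s, (w - c) ^ 1‖ ≤ (2 * R₁) ^ (1 * s.card) :=
    norm_prod_pow_le s 1 fun c hc =>
      calc ‖w - c‖ ≤ ‖w‖ + ‖c‖ := norm_sub_le w c
        _ ≤ 2 * R₁ := by linarith [hs c hc]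
  calc ‖f w‖ ≤ θ / (4 * R₁) ^ (1 * s.card) * ‖∏ c ∈ s, (w - c) ^ 1‖ := h
    _ ≤ θ / (4 * R₁) ^ (1 * s.card) * (2 * R₁) ^ (1 * s.card) := by gcongr
    _ = θ / 2 ^ s.card := by
        rw [one_mul, show (4 * R₁ : ℝ) = 2 * (2 * R₁) by ring, mul_pow]
        have : (0 : ℝ) < (2 * R₁) ^ s.card := by positivity
        field_simp

namespace Setup

/-- **The contradiction** (Lang 1966, Ch. II / Ramachandra 1968 / Waldschmidt 2009, Thm. 3.9,
for rational values): no `Setup` exists. [cite: Waldschmidt2009, Thm. 3.9] -/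
theorem elim (S : Setup) : False := by
  classical
  -- the constants
  have hX := S.X_nonneg
  have hY := S.Y_pos
  have hC₀ : (1 : ℝ) ≤ S.C₀ := by exact_mod_cast S.one_le_C₀
  set ℓ : ℝ := Real.log S.C₀ with hℓdef
  have hℓ : 0 ≤ ℓ := Real.log_nonneg hC₀
  have hC₀pow : ∀ n : ℕ, (S.C₀ : ℝ) ^ n = Real.exp (n * ℓ) := fun n => by
    rw [Real.exp_nat_mul, Real.exp_log (by positivity)]
  set κ : ℝ := 5 * S.X * S.Y + 3 * ℓ with hκdef
  have hκ0 : 0 ≤ κ := by positivity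
  set u : ℕ := ⌈4 * κ⌉₊ + 3 with hudef
  have hu3 : 3 ≤ u := by omega
  have hκu : 4 * κ ≤ u := by
    calc 4 * κ ≤ ⌈4 * κ⌉₊ := Nat.le_ceil (4 * κ)
      _ ≤ u := by rw [hudef]; push_cast; linarith
  -- Siegel's lemma at the base level
  obtain ⟨L, hLdef⟩ : ∃ L : ℕ, L = 4 * u ^ 3 := ⟨_, rfl⟩
  obtain ⟨S₀, hS₀def⟩ : ∃ S₀ : ℕ, S₀ = 2 * u ^ 2 := ⟨_, rfl⟩
  obtain ⟨a, ha0, hMa, habs⟩ := S.exists_solution u (by omega) hLdef hS₀def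
  have hS₀pos : 0 < S₀ := by rw [hS₀def]; positivity
  -- `F` vanishes on the boxes `k_j < T` for every `T ≥ S₀`
  have hP : ∀ T : ℕ, S₀ ≤ T → ∀ k : Fin 3 → ℕ, (∀ j, k j < T) → S.F L a (S.z k) = 0 := by
    intro T hT
    induction T, hT using Nat.le_induction with
    | base =>
      intro k hk
      have h : (S.D L S₀ : ℂ) * S.F L a (S.z k) = ((S.M L S₀).mulVec a (fun j => ⟨k j, hk j⟩) : ℂ) :=
        S.D_mul_F L S₀ a (fun j => ⟨k j, hk j⟩)
      rw [hMa, Pi.zero_apply, Int.cast_zero] at h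
      exact (mul_eq_zero.1 h).resolve_left (by exact_mod_cast S.D_ne_zero L S₀)
    | succ T hST ih =>
      intro k hk
      by_contra hne
      have hT1 : 1 ≤ T := le_trans hS₀pos hST
      -- the zeros already known: the box of side `T`, `T³` distinct points of modulus `≤ T·Y`
      set s : Finset ℂ := Finset.univ.image (fun k' : Fin 3 → Fin T => S.z (fun j => (k' j : ℕ)))
        with hsdef
      have hscard : s.card = T ^ 3 := by
        rw [hsdef, Finset.card_image_of_injective, Finset.card_univ]
        · simp
        · intro k₁ k₂ h12
          have := S.z_injective h12
          funext j
          exact Fin.ext (congrFun this j)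
      have hR₁ : (0 : ℝ) < T * S.Y := by positivity
      have hs : ∀ c ∈ s, ‖c‖ ≤ T * S.Y := by
        intro c hc
        rw [hsdef, Finset.mem_image] at hc
        obtain ⟨k', -, rfl⟩ := hc
        exact S.norm_z_le _ fun j => (k' j).isLt.le
      have h0 : ∀ c ∈ s, S.F L a c = 0 := by
        intro c hc
        rw [hsdef, Finset.mem_image] at hc
        obtain ⟨k', -, rfl⟩ := hc
        exact ih _ fun j => (k' j).isLt
      have hw : ‖S.z k‖ ≤ T * S.Y := S.norm_z_le k fun j => Nat.lt_succ_iff.1 (hk j)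
      -- the upper bound (Schwarz lemma with `T³` zeros, circle of radius `5·T·Y`)
      have hθ : ∀ t ∈ sphere (0 : ℂ) (5 * (T * S.Y)), ‖S.F L a t‖ ≤
          (L : ℝ) ^ 2 * ((L : ℝ) ^ 2 * (S.C₀ : ℝ) ^ (L * S₀)) *
            Real.exp (L * S.X * (5 * (T * S.Y))) := by
        intro t ht
        have ht' : ‖t‖ = 5 * (T * S.Y) := by
          have : dist t 0 = 5 * (T * S.Y) := ht
          simpa using this
        have h := S.norm_F_le L a habs t
        rwa [ht'] at h
      have hup : ‖S.F L a (S.z k)‖ ≤ (L : ℝ) ^ 2 * ((L : ℝ) ^ 2 * (S.C₀ : ℝ) ^ (L * S₀)) *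
            Real.exp (L * S.X * (5 * (T * S.Y))) / 2 ^ (T ^ 3) := by
        have := norm_le_of_forall_eq_zero (S.differentiable_F L a) s hR₁ hs h0 hθ hw
        rwa [hscard] at this
      -- the lower bound (a nonzero integer has modulus `≥ 1`)
      have hlow : 1 ≤ (S.C₀ : ℝ) ^ (L * (T + 1)) * ‖S.F L a (S.z k)‖ := by
        have h : (S.D L (T + 1) : ℂ) * S.F L a (S.z k) =
            ((S.M L (T + 1)).mulVec a (fun j => ⟨k j, hk j⟩) : ℂ) :=
          S.D_mul_F L (T + 1) a (fun j => ⟨k j, hk j⟩)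
        have hne' : (S.M L (T + 1)).mulVec a (fun j => ⟨k j, hk j⟩) ≠ 0 := by
          intro h0'
          rw [h0', Int.cast_zero] at h
          exact hne ((mul_eq_zero.1 h).resolve_left (by exact_mod_cast S.D_ne_zero L (T + 1)))
        calc (1 : ℝ) ≤ |(((S.M L (T + 1)).mulVec a (fun j => ⟨k j, hk j⟩) : ℤ) : ℝ)| := by
              rw [← Int.cast_abs]; exact_mod_cast Int.one_le_abs hne'
          _ = ‖(S.D L (T + 1) : ℂ) * S.F L a (S.z k)‖ := by rw [h, Complex.norm_intCast]
          _ ≤ (S.C₀ : ℝ) ^ (L * (T + 1)) * ‖S.F L a (S.z k)‖ := S.norm_D_mul_le L (T + 1) _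
      -- combine
      have hcomb : (2 : ℝ) ^ (T ^ 3) ≤ (S.C₀ : ℝ) ^ (L * (T + 1)) *
          ((L : ℝ) ^ 2 * ((L : ℝ) ^ 2 * (S.C₀ : ℝ) ^ (L * S₀)) *
            Real.exp (L * S.X * (5 * (T * S.Y)))) := by
        have h2 : (0 : ℝ) < 2 ^ (T ^ 3) := by positivity
        have h1 := hlow.trans (mul_le_mul_of_nonneg_left hup (by positivity))
        rw [← mul_div_assoc, le_div_iff₀ h2, one_mul] at h1
        exact h1
      -- the numerical contradiction: the right-hand side is at most `exp(T³/2) < 2^{T³}`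
      have hlin : 4 * (L : ℝ) + (((L * (T + 1) : ℕ) : ℝ) * ℓ + ((L * S₀ : ℕ) : ℝ) * ℓ +
          L * S.X * (5 * (T * S.Y))) ≤ (T : ℝ) ^ 3 / 2 := by
        have hTr : (2 : ℝ) * (u : ℝ) ^ 2 ≤ T := by
          have : ((2 * u ^ 2 : ℕ) : ℝ) ≤ T := by rw [← hS₀def]; exact_mod_cast hST
          push_cast at this
          exact this
        have hur : (3 : ℝ) ≤ u := by exact_mod_cast hu3
        have hLr : (L : ℝ) = 4 * (u : ℝ) ^ 3 := by rw [hLdef]; push_cast; ring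
        have hS₀r : (S₀ : ℝ) = 2 * (u : ℝ) ^ 2 := by rw [hS₀def]; push_cast; ring
        push_cast
        rw [hLr, hS₀r]
        have hT1r : (1 : ℝ) ≤ T := by exact_mod_cast hT1
        have h1 : (u : ℝ) ^ 3 * T * (4 * κ) ≤ (u : ℝ) ^ 3 * T * u :=
          mul_le_mul_of_nonneg_left hκu (by positivity)
        have h2 : (2 * (u : ℝ) ^ 2) ^ 2 * T ≤ (T : ℝ) ^ 2 * T :=
          mul_le_mul_of_nonneg_right (pow_le_pow_left₀ (by positivity) hTr 2) (by positivity)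
        have h3 : 4 * (u : ℝ) ≤ T := by nlinarith
        have h4 : (4 * (u : ℝ)) ^ 3 ≤ (T : ℝ) ^ 3 := pow_le_pow_left₀ (by positivity) h3 3
        have h6 : (u : ℝ) ^ 3 * ℓ * (1 + 2 * (u : ℝ) ^ 2) ≤ (u : ℝ) ^ 3 * ℓ * (2 * T) :=
          mul_le_mul_of_nonneg_left (by linarith) (by positivity)
        rw [hκdef] at h1
        nlinarith [h1, h2, h4, h6, hX, hY.le, hℓ]
      have hE : (S.C₀ : ℝ) ^ (L * (T + 1)) *
          ((L : ℝ) ^ 2 * ((L : ℝ) ^ 2 * (S.C₀ : ℝ) ^ (L * S₀)) *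
            Real.exp (L * S.X * (5 * (T * S.Y)))) ≤ Real.exp ((T : ℝ) ^ 3 / 2) := by
        have hL4 : (L : ℝ) ^ 2 * (L : ℝ) ^ 2 ≤ Real.exp (4 * L) := by
          have h1 : (L : ℝ) ≤ Real.exp L := by linarith [Real.add_one_le_exp (L : ℝ)]
          calc (L : ℝ) ^ 2 * (L : ℝ) ^ 2 = (L : ℝ) ^ 4 := by ring
            _ ≤ Real.exp L ^ 4 := pow_le_pow_left₀ (by positivity) h1 4
            _ = Real.exp (4 * L) := by rw [← Real.exp_nat_mul]; norm_num
        rw [hC₀pow, hC₀pow]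
        calc Real.exp (↑(L * (T + 1)) * ℓ) * ((L : ℝ) ^ 2 * ((L : ℝ) ^ 2 * Real.exp (↑(L * S₀) * ℓ)) *
              Real.exp (L * S.X * (5 * (T * S.Y))))
            = (L : ℝ) ^ 2 * (L : ℝ) ^ 2 *
                Real.exp (↑(L * (T + 1)) * ℓ + ↑(L * S₀) * ℓ + L * S.X * (5 * (T * S.Y))) := by
              rw [Real.exp_add, Real.exp_add]; ring
          _ ≤ Real.exp (4 * L) *
                Real.exp (↑(L * (T + 1)) * ℓ + ↑(L * S₀) * ℓ + L * S.X * (5 * (T * S.Y))) :=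
              mul_le_mul_of_nonneg_right hL4 (Real.exp_pos _).le
          _ = Real.exp (4 * L + (↑(L * (T + 1)) * ℓ + ↑(L * S₀) * ℓ + L * S.X * (5 * (T * S.Y)))) := by
              rw [← Real.exp_add]
          _ ≤ Real.exp ((T : ℝ) ^ 3 / 2) := Real.exp_le_exp.2 hlin
      have h2e : Real.exp ((T : ℝ) ^ 3 / 2) < (2 : ℝ) ^ (T ^ 3) := by
        have he : Real.exp (1 / 2 : ℝ) < 2 := by
          have h1 := Real.exp_one_lt_d9
          have hsq : Real.exp (1 / 2 : ℝ) ^ 2 = Real.exp 1 := by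
            rw [← Real.exp_nat_mul]; norm_num
          nlinarith [Real.exp_pos (1 / 2 : ℝ)]
        have hT3 : T ^ 3 ≠ 0 := pow_ne_zero 3 (by omega)
        calc Real.exp ((T : ℝ) ^ 3 / 2) = Real.exp (1 / 2) ^ (T ^ 3) := by
              rw [← Real.exp_nat_mul]; congr 1; push_cast; ring
          _ < 2 ^ (T ^ 3) := pow_lt_pow_left₀ he (Real.exp_pos _).le hT3
      linarith
  -- hence `F` vanishes at every lattice point, and Artin's theorem kills the coefficients
  have hall : ∀ k : Fin 3 → ℕ, S.F L a (S.z k) = 0 := fun k =>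
    hP (max S₀ (Finset.univ.sup k + 1)) (le_max_left _ _) k fun j =>
      lt_max_of_lt_right (Nat.lt_succ_of_le (Finset.le_sup (Finset.mem_univ j)))
  exact ha0 (S.eq_zero_of_forall_F_eq_zero L a hall)

end Setup

end SixExpRat

/-! ### The theorems -/

/-- **Six exponentials theorem, rational values** (Lang 1966, Ch. II, §1, Thm. 1; Ramachandra
1968; the case communicated by Siegel to Alaoglu–Erdős, 1944, p. 455): if `x₁, x₂ ∈ ℂ` are
`ℚ`-linearly independent and `y₁, y₂, y₃ ∈ ℂ` are `ℚ`-linearly independent, then the six numbers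
`e^{xᵢ yⱼ}` are not all rational. This is the special case of `Literature.NumberTheory.Transcendental.six_exponentials`
(**periods.S14**, algebraic values) that the tree consumes, proved here outright.
[cite: Lang1966, Ch. II §1 Thm. 1] -/
theorem six_exponentials_rat (x : Fin 2 → ℂ) (y : Fin 3 → ℂ) (hx : LinearIndependent ℚ x)
    (hy : LinearIndependent ℚ y) : ∃ i j, ∀ q : ℚ, cexp (x i * y j) ≠ q := by
  by_contra h
  push Not at h
  choose r hr using h
  exact (SixExpRat.Setup.mk x y hx hy r hr).elim

/-- The named fact `Literature.NumberTheory.Transcendental.six_exponentials` (algebraic values) implies the rational case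
(rational numbers are algebraic) — recorded to document that `six_exponentials_rat` is a
specialisation, not a variant. [cite: Lang1966, Ch. II §1 Thm. 1] -/
theorem six_exponentials_rat_of_six_exponentials (h : six_exponentials) (x : Fin 2 → ℂ)
    (y : Fin 3 → ℂ) (hx : LinearIndependent ℚ x) (hy : LinearIndependent ℚ y) :
    ∃ i j, ∀ q : ℚ, cexp (x i * y j) ≠ q := by
  obtain ⟨i, j, hij⟩ := h x y hx hy
  exact ⟨i, j, fun q hq => hij (by rw [hq]; exact isAlgebraic_algebraMap q)⟩

end Literature.NumberTheory.Transcendental
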